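import Summits.HodgeConjecture.HodgeConjecture.Theorems.H413CohFormsHodgeTypesDisjoint
import Summits.HodgeConjecture.HodgeConjecture.Theorems.P4StubT1ArchFactor
import Mathlib.LinearAlgebra.Projection
import HarnessLib

/-!
# FLOOR-0 P4 — stub S3 `stub_T2c_cohClassMapOfHol`: extending a holomorphic class map to `(1,0) ⊕ (0,1)` by conjugation

Cell hodgecm-mathlib (D-0151; human ruling D-0183, FLOOR 0), crux item H413 = stmt-HodgeConjecture-24833, programme P4 «admissible occurs
in H¹», planner line of record `F0/P4/line-F0-P4AdmissibleOccursInH1.lean` (F0P4-plan (g0), sha16 98373f7d; director s341), stub **S3 = T2c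
`StubT2cCohClassMapOfHol`** (M⁻, GENERIC — no pin, no tower).  Author A-p08 (g15).  PROOF lane (theorems only; no `def`, no instance, no
notation, no named fact, no `sorry`); `--supports stmt-HodgeConjecture-24833 --as helper`.  HC_CM is proved only modulo the 7 printed
citations until rung 0 closes; this file proves nothing about them.

THE STATEMENT (restated token for token from the line, §3 below): for every CM face `(F, V)`, every `ℂ[U(V)(𝔸_{F⁺,f})]`-module `(H, ρ)`,
every subspace `P ≤ H`, every INJECTIVE `ρ`-EQUIVARIANT `cls₁₀ : holCotForms 𝔞₀ → H` with values in `P` (`𝔞₀ = archFactorOf F V`, the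
archimedean factor of record of ★ `Theorems/H413CohFormsCarriers`) and every INJECTIVE `ρ`-EQUIVARIANT CONJUGATE-LINEAR `cB : H → H` with
`P ∩ cB P = 0`, there is an INJECTIVE `ρ`-EQUIVARIANT `cls : cohForms 𝔞₀ → H` (`cohForms 𝔞₀ = holCotForms 𝔞₀ ⊔ conjFun (holCotForms 𝔞₀)`).

THE PROOF ([BorelWallach2000] VII 2.10 ∕ 3.6: the `(p,q)`-decomposition of cohomological automorphic forms; here only `(1,0) ⊕ (0,1)`):
* §1 the two Hodge types are COMPLEMENTARY inside `cohForms 𝔞` — IN THE TREE BY NAME: ★ `Theorems/H413CohFormsHodgeTypesDisjoint`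
  (A-p09 (g18): `disjoint_holCotForms_map_conjFun`, `isCompl_holCotForms_map_conjFun`; the right `K_∞`-type at the central `diag(1,1,i)` of
  `Stab_{U(2,1)}(x₀) = U(2) × U(1)` is a non-real scalar), imported, not re-proved; here only the bookkeeping lemma `conjFun_mem_holCotForms_of_mem_map`;
* §2 Mathlib's `LinearMap.ofIsCompl` glues `cls (f + conjFun f') := cls₁₀ f + cB (cls₁₀ f')` (the second summand is `ℂ`-linear in `conjFun f'`:
  conjugate-linear ∘ linear ∘ conjugate-linear);
* §2 (cont.) `cls` is injective (from `P ∩ cB P = 0` and the two injectivities) and `ρ`-equivariant (because `conjFun` commutes with `rightRep`, ★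
  `conjFun_rightRep`, and `holCotForms 𝔞₀` is `rightRep`-stable for the honest factor of record, ★ `ArchFactor.IsHonest.rightRep_mem_holCotForms`
  + ★ `archFactorOf_isHonest`);
* §3 the head `stubT2cCohClassMapOfHol_holds`, binder for binder the body of the registered stub.

## References
* [BorelWallach2000] A. Borel, N. Wallach, *Continuous cohomology, discrete subgroups, and representations of reductive groups*, 2nd ed. (2000),
  VII 2.10 and 3.6.
* [Borel1997] A. Borel, *Automorphic forms on SL₂(ℝ)* (1997), §5.14.
* Tree: ★ `Theorems/H413CohFormsCarriers` (`holCotForms`, `cohForms`, `conjFun`, `rightRep`, `archFactorOf`), ★ `Theorems/H413CohFormsCarriersLemmas`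
  (`conjFun_conjFun`, `conjFun_rightRep`, `IsHonest.rightRep_mem_holCotForms`), ★ `Theorems/H413CohFormsHodgeTypesDisjoint`
  (`isCompl_holCotForms_map_conjFun`), ★ `Theorems/P4StubT1ArchFactor` (`archFactorOf_isHonest`).
-/

set_option autoImplicit false
set_option linter.dupNamespace false

noncomputable section

namespace Summit.HodgeConjecture.HodgeConjecture.Cruxes.H413.P4StubT2cCohClassMapOfHol

open MulAction
open Literature.NumberTheory.Automorphic
open Literature.AlgebraicGeometry.ShimuraVarieties
open Summit.HodgeConjecture.HodgeConjecture.Cruxes.H413.CohFormsCarriers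
open Summit.HodgeConjecture.HodgeConjecture.Cruxes.H413.P4StubT1ArchFactor (archFactorOf_isHonest)

variable {F : HodgeCM.CMField} {ι₁ : F →+* ℂ} {V : HodgeCM.HermSpace3 F ι₁}

/-! ## §1 Bookkeeping on the antiholomorphic summand -/

/-- A conjugate of a holomorphic cotangent form has a holomorphic conjugate. [cite: BorelWallach2000, VII 2.10 and 3.6] -/
theorem conjFun_mem_holCotForms_of_mem_map {𝔞 : ArchFactor F V} {b : (adelicDatum F V).Adelic → (Fin 2 → ℂ)}
    (hb : b ∈ (holCotForms 𝔞).map (conjFun F V)) : conjFun F V b ∈ holCotForms 𝔞 := by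
  obtain ⟨a, ha, rfl⟩ := Submodule.mem_map.1 hb
  rw [conjFun_conjFun]
  exact ha

/-! ## §2 The extension `cls (f + conjFun f') = cls₁₀ f + cB (cls₁₀ f')` -/

section Extension

variable (𝔞 : ArchFactor F V) {H : Type} [AddCommGroup H] [Module ℂ H]
  (cls₁₀ : ↥(holCotForms 𝔞) →ₗ[ℂ] H) (cB : H →ₛₗ[starRingEnd ℂ] H)

/-- The holomorphic summand of the extension: `cls₁₀` read on `holCotForms 𝔞 ≤ cohForms 𝔞`. [cite: BorelWallach2000, VII 2.10 and 3.6] -/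
theorem exists_holPart :
    ∃ φ : ↥((holCotForms 𝔞).comap (cohForms 𝔞).subtype) →ₗ[ℂ] H,
      ∀ u, φ u = cls₁₀ ⟨(u : ↥(cohForms 𝔞)), u.2⟩ :=
  ⟨{ toFun := fun u => cls₁₀ ⟨(u : ↥(cohForms 𝔞)), u.2⟩
     map_add' := fun u v => by rw [← map_add]; rfl
     map_smul' := fun c u => by rw [← map_smul]; rfl }, fun _ => rfl⟩

/-- The antiholomorphic summand of the extension: `b ↦ cB (cls₁₀ (conjFun b))` on `conjFun (holCotForms 𝔞) ≤ cohForms 𝔞` — `ℂ`-LINEAR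
(conjugate-linear ∘ linear ∘ conjugate-linear). [cite: BorelWallach2000, VII 2.10 and 3.6] -/
theorem exists_antiholPart :
    ∃ ψ : ↥(((holCotForms 𝔞).map (conjFun F V)).comap (cohForms 𝔞).subtype) →ₗ[ℂ] H,
      ∀ u, ψ u = cB (cls₁₀ ⟨conjFun F V (u : ↥(cohForms 𝔞)), conjFun_mem_holCotForms_of_mem_map u.2⟩) := by
  refine ⟨{ toFun := fun u => cB (cls₁₀ ⟨conjFun F V (u : ↥(cohForms 𝔞)), conjFun_mem_holCotForms_of_mem_map u.2⟩)
            map_add' := fun u v => ?_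
            map_smul' := fun c u => ?_ }, fun _ => rfl⟩
  · have h : (⟨conjFun F V ((u + v : ↥(((holCotForms 𝔞).map (conjFun F V)).comap (cohForms 𝔞).subtype)) : ↥(cohForms 𝔞)),
          conjFun_mem_holCotForms_of_mem_map (u + v).2⟩ : ↥(holCotForms 𝔞)) =
        ⟨conjFun F V (u : ↥(cohForms 𝔞)), conjFun_mem_holCotForms_of_mem_map u.2⟩ +
          ⟨conjFun F V (v : ↥(cohForms 𝔞)), conjFun_mem_holCotForms_of_mem_map v.2⟩ := by
      apply Subtype.ext
      show conjFun F V ((u : ↥(cohForms 𝔞)) + (v : ↥(cohForms 𝔞)) : (adelicDatum F V).Adelic → (Fin 2 → ℂ)) =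
        conjFun F V (u : ↥(cohForms 𝔞)) + conjFun F V (v : ↥(cohForms 𝔞))
      exact map_add (conjFun F V) _ _
    rw [h, map_add, map_add]
  · have h : (⟨conjFun F V ((c • u : ↥(((holCotForms 𝔞).map (conjFun F V)).comap (cohForms 𝔞).subtype)) : ↥(cohForms 𝔞)),
          conjFun_mem_holCotForms_of_mem_map (c • u).2⟩ : ↥(holCotForms 𝔞)) =
        starRingEnd ℂ c • ⟨conjFun F V (u : ↥(cohForms 𝔞)), conjFun_mem_holCotForms_of_mem_map u.2⟩ := by
      apply Subtype.ext
      show conjFun F V (c • ((u : ↥(cohForms 𝔞)) : (adelicDatum F V).Adelic → (Fin 2 → ℂ))) =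
        starRingEnd ℂ c • conjFun F V (u : ↥(cohForms 𝔞))
      exact LinearMap.map_smulₛₗ (conjFun F V) c _
    rw [h, LinearMap.map_smul, LinearMap.map_smulₛₗ cB, starRingEnd_self_apply, RingHom.id_apply]

end Extension

/-- **The extension and its two defining properties** (generic `H`, `ρ`, `P`, `cls₁₀`, `cB`; for the HONEST factor of record `𝔞₀ = archFactorOf F V`).
[cite: BorelWallach2000, VII 2.10 and 3.6] -/
theorem exists_cohClassMap_of_hol (F : HodgeCM.CMField) {ι₁ : F →+* ℂ} (V : HodgeCM.HermSpace3 F ι₁) (H : Type) [AddCommGroup H] [Module ℂ H]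
    (ρ : Representation ℂ ↥(HodgeCM.HermSpace3.adelicFin V) H) (P : Submodule ℂ H)
    (cls₁₀ : ↥(holCotForms (archFactorOf F V)) →ₗ[ℂ] H) (hinj : Function.Injective cls₁₀)
    (hequiv : ∀ (g : ↥(HodgeCM.HermSpace3.adelicFin V)) (f : ↥(holCotForms (archFactorOf F V)))
        (hgf : rightRep F V g (f : _) ∈ holCotForms (archFactorOf F V)),
        cls₁₀ ⟨rightRep F V g (f : _), hgf⟩ = ρ g (cls₁₀ f))
    (hP : ∀ f : ↥(holCotForms (archFactorOf F V)), cls₁₀ f ∈ P)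
    (cB : H →ₛₗ[starRingEnd ℂ] H) (hcB : Function.Injective cB)
    (hcBρ : ∀ (g : ↥(HodgeCM.HermSpace3.adelicFin V)) (x : H), cB (ρ g x) = ρ g (cB x))
    (hdisj : ∀ x y : H, x ∈ P → y ∈ P → cB y = x → x = 0) :
    ∃ cls : ↥(cohForms (archFactorOf F V)) →ₗ[ℂ] H,
      Function.Injective cls ∧
        ∀ (g : ↥(HodgeCM.HermSpace3.adelicFin V)) (f : ↥(cohForms (archFactorOf F V)))
          (hgf : rightRep F V g (f : _) ∈ cohForms (archFactorOf F V)),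
          cls ⟨rightRep F V g (f : _), hgf⟩ = ρ g (cls f) := by
  have h𝔞 : (archFactorOf F V).IsHonest := archFactorOf_isHonest F V
  have hc := isCompl_holCotForms_map_conjFun (archFactorOf F V)
  obtain ⟨φ, hφ⟩ := exists_holPart (archFactorOf F V) cls₁₀
  obtain ⟨ψ, hψ⟩ := exists_antiholPart (archFactorOf F V) cls₁₀ cB
  -- the decomposition of a cohomological form and the value of the glued map on it
  have key : ∀ (a : (adelicDatum F V).Adelic → (Fin 2 → ℂ)) (ha : a ∈ holCotForms (archFactorOf F V))
      (a₂ : (adelicDatum F V).Adelic → (Fin 2 → ℂ)) (ha₂ : a₂ ∈ holCotForms (archFactorOf F V))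
      (h : a + conjFun F V a₂ ∈ cohForms (archFactorOf F V)),
      LinearMap.ofIsCompl hc φ ψ ⟨a + conjFun F V a₂, h⟩ = cls₁₀ ⟨a, ha⟩ + cB (cls₁₀ ⟨a₂, ha₂⟩) := by
    intro a ha a₂ ha₂ h
    have ha' : a ∈ cohForms (archFactorOf F V) := holCotForms_le_cohForms (archFactorOf F V) ha
    have hb' : conjFun F V a₂ ∈ cohForms (archFactorOf F V) := conjFun_mem_cohForms_of_mem_holCotForms ha₂
    have hu : (⟨a, ha'⟩ : ↥(cohForms (archFactorOf F V))) ∈ (holCotForms (archFactorOf F V)).comap (cohForms (archFactorOf F V)).subtype := ha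
    have hv : (⟨conjFun F V a₂, hb'⟩ : ↥(cohForms (archFactorOf F V))) ∈ ((holCotForms (archFactorOf F V)).map (conjFun F V)).comap (cohForms (archFactorOf F V)).subtype :=
      Submodule.mem_map_of_mem ha₂
    have hsplit : (⟨a + conjFun F V a₂, h⟩ : ↥(cohForms (archFactorOf F V))) =
        ((⟨⟨a, ha'⟩, hu⟩ : ↥((holCotForms (archFactorOf F V)).comap (cohForms (archFactorOf F V)).subtype)) : ↥(cohForms (archFactorOf F V))) +
          ((⟨⟨conjFun F V a₂, hb'⟩, hv⟩ : ↥(((holCotForms (archFactorOf F V)).map (conjFun F V)).comap (cohForms (archFactorOf F V)).subtype)) : ↥(cohForms (archFactorOf F V))) :=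
      Subtype.ext rfl
    rw [hsplit, map_add, LinearMap.ofIsCompl_apply_left, LinearMap.ofIsCompl_apply_right, hφ, hψ]
    have hcc : (⟨conjFun F V (conjFun F V a₂), conjFun_mem_holCotForms_of_mem_map hv⟩ : ↥(holCotForms (archFactorOf F V))) =
        ⟨a₂, ha₂⟩ := Subtype.ext (conjFun_conjFun F V a₂)
    exact congrArg (fun z => cls₁₀ ⟨a, ha⟩ + cB (cls₁₀ z)) hcc
  refine ⟨LinearMap.ofIsCompl hc φ ψ, ?_, ?_⟩
  · -- injectivity
    rw [← LinearMap.ker_eq_bot, Submodule.eq_bot_iff]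
    rintro ⟨f, hf⟩ hf0
    rw [LinearMap.mem_ker] at hf0
    obtain ⟨a, ha, b, hb, hab⟩ := Submodule.mem_sup.1 hf
    obtain ⟨a₂, ha₂, rfl⟩ := Submodule.mem_map.1 hb
    have h : (⟨f, hf⟩ : ↥(cohForms (archFactorOf F V))) = ⟨a + conjFun F V a₂, hab.symm ▸ hf⟩ := Subtype.ext hab.symm
    rw [h, key a ha a₂ ha₂] at hf0
    -- `cls₁₀ a = cB (cls₁₀ (-a₂))` with both arguments in `P`
    have h1 : cB (cls₁₀ ⟨-a₂, Submodule.neg_mem _ ha₂⟩) = cls₁₀ ⟨a, ha⟩ := by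
      have hneg : (⟨-a₂, Submodule.neg_mem _ ha₂⟩ : ↥(holCotForms (archFactorOf F V))) = -⟨a₂, ha₂⟩ := rfl
      rw [hneg, map_neg, map_neg, eq_comm, eq_neg_iff_add_eq_zero]
      exact hf0
    have h2 : cls₁₀ ⟨a, ha⟩ = 0 := hdisj _ _ (hP _) (hP _) h1
    have ha0 : a = 0 := by
      have := hinj (h2.trans (map_zero cls₁₀).symm)
      exact congrArg Subtype.val this
    have h3 : cB (cls₁₀ ⟨a₂, ha₂⟩) = 0 := by
      rw [h2, zero_add] at hf0
      exact hf0
    have ha₂0 : a₂ = 0 := by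
      have h4 : cls₁₀ ⟨a₂, ha₂⟩ = 0 := hcB (h3.trans (map_zero cB).symm)
      exact congrArg Subtype.val (hinj (h4.trans (map_zero cls₁₀).symm))
    apply Subtype.ext
    show f = 0
    rw [← hab, ha0, ha₂0, map_zero, add_zero]
  · -- equivariance
    rintro g ⟨f, hf⟩ hgf
    obtain ⟨a, ha, b, hb, hab⟩ := Submodule.mem_sup.1 hf
    obtain ⟨a₂, ha₂, rfl⟩ := Submodule.mem_map.1 hb
    have hga : rightRep F V g a ∈ holCotForms (archFactorOf F V) := h𝔞.rightRep_mem_holCotForms ha g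
    have hga₂ : rightRep F V g a₂ ∈ holCotForms (archFactorOf F V) := h𝔞.rightRep_mem_holCotForms ha₂ g
    have hsum : rightRep F V g f = rightRep F V g a + conjFun F V (rightRep F V g a₂) := by
      rw [← hab, map_add, conjFun_rightRep]
    have h : (⟨f, hf⟩ : ↥(cohForms (archFactorOf F V))) = ⟨a + conjFun F V a₂, hab.symm ▸ hf⟩ := Subtype.ext hab.symm
    have h' : (⟨rightRep F V g f, hgf⟩ : ↥(cohForms (archFactorOf F V))) =
        ⟨rightRep F V g a + conjFun F V (rightRep F V g a₂), hsum ▸ hgf⟩ := Subtype.ext hsum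
    rw [h', key _ hga _ hga₂, h, key a ha a₂ ha₂, map_add, hequiv g ⟨a, ha⟩ hga, hequiv g ⟨a₂, ha₂⟩ hga₂, hcBρ]

/-! ## §3 The head: the registered stub S3, binder for binder -/

/-- **P4 stub S3 `StubT2cCohClassMapOfHol`, closed by name** (the body of `…Cruxes.H413.F0P4AdmissibleOccursInH1.StubT2cCohClassMapOfHol` of the
planner line `Lines/F0-P4AdmissibleOccursInH1.lean`, token for token, so that `stub_T2c_cohClassMapOfHol := stubT2cCohClassMapOfHol_holds`).
[cite: BorelWallach2000, VII 2.10 and 3.6] [cite: Borel1997, §5.14] -/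
theorem stubT2cCohClassMapOfHol_holds :
    ∀ (F : HodgeCM.CMField) {ι₁ : F →+* ℂ} (V : HodgeCM.HermSpace3 F ι₁) (H : Type) [AddCommGroup H] [Module ℂ H]
      (ρ : Representation ℂ ↥(HodgeCM.HermSpace3.adelicFin V) H) (P : Submodule ℂ H)
      (cls₁₀ : ↥(holCotForms (archFactorOf F V)) →ₗ[ℂ] H),
      Function.Injective cls₁₀ →
        (∀ (g : ↥(HodgeCM.HermSpace3.adelicFin V)) (f : ↥(holCotForms (archFactorOf F V)))
            (hgf : rightRep F V g (f : _) ∈ holCotForms (archFactorOf F V)),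
            cls₁₀ ⟨rightRep F V g (f : _), hgf⟩ = ρ g (cls₁₀ f)) →
          (∀ f : ↥(holCotForms (archFactorOf F V)), cls₁₀ f ∈ P) →
            ∀ (cB : H →ₛₗ[starRingEnd ℂ] H), Function.Injective cB →
              (∀ (g : ↥(HodgeCM.HermSpace3.adelicFin V)) (x : H), cB (ρ g x) = ρ g (cB x)) →
                (∀ x y : H, x ∈ P → y ∈ P → cB y = x → x = 0) →
                  ∃ cls : ↥(cohForms (archFactorOf F V)) →ₗ[ℂ] H,
                    Function.Injective cls ∧
                      ∀ (g : ↥(HodgeCM.HermSpace3.adelicFin V)) (f : ↥(cohForms (archFactorOf F V)))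
                        (hgf : rightRep F V g (f : _) ∈ cohForms (archFactorOf F V)),
                        cls ⟨rightRep F V g (f : _), hgf⟩ = ρ g (cls f) :=
  fun F _ V H _ _ ρ P cls₁₀ hinj hequiv hP cB hcB hcBρ hdisj =>
    exists_cohClassMap_of_hol F V H ρ P cls₁₀ hinj hequiv hP cB hcB hcBρ hdisj

end Summit.HodgeConjecture.HodgeConjecture.Cruxes.H413.P4StubT2cCohClassMapOfHol

end
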